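import Mathlib
import HarnessLib

/-!
# LINE (A) `product_plus_one` — the r = 1 rung of the floor `OneChangeFloorK3`: STATE-SPACE vocabulary (definitions only)

Crux item stmt-ValiantsHypothesis-18050 (`MatrixDescartes`), LINE (A) `Cruxes/MatrixDescartes/Lines/product_plus_one.lean`
(registered skeleton 4c66814e33f05045; open stubs `stub_oneChangeFloorK3` / `stub_classRowK3` / `stub_eulerBoundK3` / `stub_polyLaw`).
The r = 1 rung of the floor is the company «one W row `−α + κX^a + γX^c` × `k` ZERO-CHANGE rows `p_i + q_i X^a + s_i X^c`»
(pen val-idea-25 g9 NOTE §56; refereed by val-idea-crit-1 g10/g11 #407–#435 and val-idea-crit-6 g11/g12 #95–#107).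
Its exact one-function form (crit-1 #417): the positive critical points are governed by the BLOCK QUOTIENT
`F_B = Ω_B e^{−cu}/Π P_i`, `Ω_B = ψ_B' − aψ_B − ψ_B²`; (U1) «`U⁺ = {Ω_B > 0}` is an interval» and (U2) «`F_B` has only maxima
on `U⁺`» give T3♮ ⇒ T3♯ (≤ 3 critical points, every `k`).

This file is crit-1 g11's STATE-SPACE TYPING of that rung, VERBATIM (source: pen HOME
`pub/ideators/val-idea-25/abprobe/s59/card/Sketch-T3-s59.lean` rev 11, sha16 3c1b0a5138581e6c, §StateSpace + rev 9/11 defs, farm rc 0;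
typed text by val-idea-crit-1 g11 RESEARCH NOTES #430–#433): in a-units the letters are `0, 1, ρ` (`ρ = c/a > 1`); a row's tilted
state is (mean `E`, top mass `π`), raw moments `μ_j = (E − ρπ) + π ρ^j`; block cumulants `κ₁..κ₄` add over rows (`bk1..bk4`);
along the flow `u ↦ u + t` one has `dκ_j/du = κ_{j+1}`, so `Ω = κ₂ − κ₁ − κ₁²` (`sOmega`), `Ω' = κ₃ − κ₂ − 2κ₁κ₂` (`sOmega1`),
`Ω'' = κ₄ − κ₃ − 2κ₂² − 2κ₁κ₃` (`sOmega2`), `K = Ω' − (ρ+κ₁)Ω` with `F_B' = K e^{−cu}/ΠP_i` (`sK`, `sK1`), and the gauged slope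
`h = Ω' + Ω(κ₁ − β)` (`sh`, `sh1`).  The four predicates are the pointwise criteria of the programme:
`PointwiseU1 k` ((P-U1), conjectural for `k ≥ 3`), `PointwiseU2 k` ((P-U2) = (★)), `OmegaLogConcave k` (crit-1's CONJECTURE E /
ΩLC; THEOREM E∞ on paper for every `k`, pen §56.24, crit-1 #434 / crit-6 #105 PASS), `ConcaveNumerator k` (crit-1's CONJECTURE F;
TRUE for `k ≤ 2`, FALSE for `k ≥ 3` — crit-6 DATUM #70, witness three rows `E = 1/10`, `π = 1/100`, `ρ = 10`).
The kernel theorems (`OmegaLogConcave_implies_PointwiseU2`, `ConcaveNumerator_implies_OmegaLogConcave`, the `k ≤ 2` cases) are in the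
companion proof files `…ZeroChangeStateOneRow` / `…ZeroChangeStateTwoRows`.

Plain `def`s of real numbers / `Prop`-valued predicates with the row-count parameter `k`; no structure / instance / notation /
axiom / named fact.  HONEST FRAMING: definitions only; nothing here closes a stub of LINE (A); `OneChangeFloorK3`, 18050,
`MatrixDescartes` OPEN; `VP ≠ VNP` is NOT proved.
-/

set_option linter.dupNamespace false

namespace Summit.ValiantsHypothesis.ValiantsHypothesis.Theorems.LacunarySymmetroidMatrixDescartes

namespace ZeroChangeState

open Finset
open scoped BigOperators

variable {k : ℕ}

/-- Raw moment `μ_j = (E − ρπ)·1^j + π·ρ^j` of row `i` in the tilted state (mean `E i`, top mass `π i`) on the letters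
`{0, 1, ρ}` (a-units); for `j ≥ 1` (crit-1 g11, Sketch-T3 rev 11 `rowMoment`, verbatim). -/
def rowMoment (ρ : ℝ) (E π : Fin k → ℝ) (j : ℕ) (i : Fin k) : ℝ := (E i - ρ * π i) + π i * ρ ^ j

/-- Block first cumulant `κ₁ = Σ_i μ₁(i) = Σ_i E i` (the block's log-slope `ψ_B` in a-units). -/
def bk1 (ρ : ℝ) (E π : Fin k → ℝ) : ℝ := ∑ i, rowMoment ρ E π 1 i

/-- Block second cumulant `κ₂ = Σ_i (μ₂ − μ₁²)` (`= ψ_B'`, the sum of the row variances). -/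
def bk2 (ρ : ℝ) (E π : Fin k → ℝ) : ℝ := ∑ i, (rowMoment ρ E π 2 i - (rowMoment ρ E π 1 i) ^ 2)

/-- Block third cumulant `κ₃ = Σ_i (μ₃ − 3μ₂μ₁ + 2μ₁³)`. -/
def bk3 (ρ : ℝ) (E π : Fin k → ℝ) : ℝ :=
  ∑ i, (rowMoment ρ E π 3 i - 3 * rowMoment ρ E π 2 i * rowMoment ρ E π 1 i + 2 * (rowMoment ρ E π 1 i) ^ 3)

/-- Block fourth cumulant `κ₄ = Σ_i (μ₄ − 4μ₃μ₁ − 3μ₂² + 12μ₂μ₁² − 6μ₁⁴)`. -/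
def bk4 (ρ : ℝ) (E π : Fin k → ℝ) : ℝ :=
  ∑ i, (rowMoment ρ E π 4 i - 4 * rowMoment ρ E π 3 i * rowMoment ρ E π 1 i - 3 * (rowMoment ρ E π 2 i) ^ 2
    + 12 * rowMoment ρ E π 2 i * (rowMoment ρ E π 1 i) ^ 2 - 6 * (rowMoment ρ E π 1 i) ^ 4)

/-- `Ω = κ₂ − κ₁ − κ₁²` — the state-space value of `Ω_B = ψ_B' − aψ_B − ψ_B²` (a-units); `U⁺ = {Ω > 0}`. -/
def sOmega (ρ : ℝ) (E π : Fin k → ℝ) : ℝ := bk2 ρ E π - bk1 ρ E π - (bk1 ρ E π) ^ 2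

/-- `Ω' = κ₃ − κ₂ − 2κ₁κ₂` — the flow derivative of `Ω` (`dκ_j/du = κ_{j+1}`). -/
def sOmega1 (ρ : ℝ) (E π : Fin k → ℝ) : ℝ := bk3 ρ E π - bk2 ρ E π - 2 * bk1 ρ E π * bk2 ρ E π

/-- `Ω'' = κ₄ − κ₃ − 2κ₂² − 2κ₁κ₃` — the second flow derivative of `Ω`. -/
def sOmega2 (ρ : ℝ) (E π : Fin k → ℝ) : ℝ :=
  bk4 ρ E π - bk3 ρ E π - 2 * (bk2 ρ E π) ^ 2 - 2 * bk1 ρ E π * bk3 ρ E π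

/-- Feasibility of a state: every row is a genuine probability vector on `{0, 1, ρ}` — top mass `π i ≥ 0`, middle mass
`E i − ρ π i ≥ 0`, and positive bottom mass `1 − (E i − ρ π i) − π i > 0` (crit-1 g11 `Feasible`, verbatim). [typed predicate of LINE (A)'s r = 1 rung, crit-1 g11 / pen val-idea-25 g9 Sketch-T3 rev 11; a programme statement, not a literature fact — no citation exists] -/
def Feasible (ρ : ℝ) (E π : Fin k → ℝ) : Prop :=
  ∀ i, 0 ≤ π i ∧ 0 ≤ E i - ρ * π i ∧ (E i - ρ * π i) + π i < 1

/-- `K = Ω' − (ρ + κ₁)Ω` (crit-1 #417: `F_B' = K·e^{−cu}/ΠP_i`, so the critical points of the block quotient on `U⁺` are the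
zeros of `K`). -/
def sK (ρ : ℝ) (E π : Fin k → ℝ) : ℝ := sOmega1 ρ E π - (ρ + bk1 ρ E π) * sOmega ρ E π

/-- The flow derivative `K' = Ω'' − (ρ + κ₁)Ω' − κ₂Ω` of `K`. -/
def sK1 (ρ : ℝ) (E π : Fin k → ℝ) : ℝ :=
  sOmega2 ρ E π - (ρ + bk1 ρ E π) * sOmega1 ρ E π - bk2 ρ E π * sOmega ρ E π

/-- The located gauge rule in a-units: `β = ρ` if `2 ≤ ρ`, else `β = 1` (pen §56.17). -/
noncomputable def sβ (ρ : ℝ) : ℝ := if 2 ≤ ρ then ρ else 1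

/-- The gauged slope `h = Ω' + Ω(κ₁ − β)` (`G_B' = h·ΠP_i·e^{−βu}` for the gauged block function `G_B = Ω_B ΠP_i e^{−βu}`). -/
noncomputable def sh (ρ : ℝ) (E π : Fin k → ℝ) : ℝ := sOmega1 ρ E π + sOmega ρ E π * (bk1 ρ E π - sβ ρ)

/-- The flow derivative `h' = Ω'' + Ω'(κ₁ − β) + Ωκ₂` of the gauged slope. -/
noncomputable def sh1 (ρ : ℝ) (E π : Fin k → ℝ) : ℝ :=
  sOmega2 ρ E π + sOmega1 ρ E π * (bk1 ρ E π - sβ ρ) + sOmega ρ E π * bk2 ρ E π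

/-- (P-U1), pointwise on the state space (crit-1 g11 / pen §56.17, rev 10 typing, verbatim): for `ρ > 2`, at feasible states
where the block is not constant (`0 < κ₁`), every critical point of the gauged `G_B` is a strict local maximum
(`h = 0 ⇒ h' < 0`).  Kernel for `k = 1` (`PointwiseU1_one`); CONJECTURAL for `k ≥ 2` (located, 0 violations; pen §56.25/§56.28). [typed predicate of LINE (A)'s r = 1 rung, crit-1 g11 / pen val-idea-25 g9 Sketch-T3 rev 11; a programme statement, not a literature fact — no citation exists] -/
def PointwiseU1 (k : ℕ) : Prop :=
  ∀ ρ : ℝ, 2 < ρ → ∀ (E π : Fin k → ℝ), Feasible ρ E π → 0 < bk1 ρ E π →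
    sh ρ E π = 0 → sh1 ρ E π < 0

/-- (P-U2) = (★), pointwise on the state space (crit-1 g11, verbatim): inside `U⁺ = {Ω > 0}` every zero of `K` is a strict
down-crossing (`K = 0 ⇒ K' < 0`), so the block quotient `F_B` has only local maxima on `U⁺`.  A THEOREM for every `k` on paper
(consequence of ΩLC = THEOREM E∞, pen §56.24); kernel for `k ≤ 2` (`PointwiseU2_one`, `PointwiseU2_two`). [typed predicate of LINE (A)'s r = 1 rung, crit-1 g11 / pen val-idea-25 g9 Sketch-T3 rev 11; a programme statement, not a literature fact — no citation exists] -/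
def PointwiseU2 (k : ℕ) : Prop :=
  ∀ ρ : ℝ, 1 < ρ → ∀ (E π : Fin k → ℝ), Feasible ρ E π → 0 < sOmega ρ E π → sK ρ E π = 0 → sK1 ρ E π < 0

/-- crit-1 #430's CONJECTURE E / ΩLC (typed text verbatim): on `U⁺ = {Ω > 0}`, `Ω·Ω'' < Ω'²`, i.e. `u ↦ log Ω_B(u)` is strictly
concave on every component of `U⁺`; it implies `PointwiseU2 k` (`OmegaLogConcave_implies_PointwiseU2`, kernel, every `k`).
STATUS: THEOREM E∞ on paper for EVERY `k` and every `ρ` (pen §56.24: `4A·(Ω'² − ΩΩ'') = (2Aρ + B)² + Ω·G₀`, `G₀ > 0` by a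
k-free power-sum certificate; crit-1 #434 / crit-6 #105 PASS); kernel for `k = 1` (sharp, crit-1 g11) and `k = 2`
(via `ConcaveNumerator 2`).  Junk-safe: `k = 0` and the zero state have `sOmega = 0`. [typed predicate of LINE (A)'s r = 1 rung, crit-1 g11 / pen val-idea-25 g9 Sketch-T3 rev 11; a programme statement, not a literature fact — no citation exists] -/
def OmegaLogConcave (k : ℕ) : Prop :=
  ∀ ρ : ℝ, 1 < ρ → ∀ (E π : Fin k → ℝ), Feasible ρ E π → 0 < sOmega ρ E π →
    sOmega ρ E π * sOmega2 ρ E π < sOmega1 ρ E π ^ 2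

/-- crit-1 g11 #433's CONJECTURE F («concave numerator», typed text verbatim): `M_B(u) = e^{−ρu}·Ω_B(u)·Π_i P_i(e^u)²` is concave,
pointwise `M'' = Ω'' + 2(2κ₁ − ρ)Ω' + ((2κ₁ − ρ)² + 2κ₂)Ω ≤ 0` at every feasible state (no `U⁺` restriction).  It implies ΩLC for the
same `k` (`ConcaveNumerator_implies_OmegaLogConcave`, kernel).  TRUE for `k = 1` (crit-1) and `k = 2` (pen THEOREM F♯₂, kernel);
FALSE for `k ≥ 3` (crit-6 DATUM #70: three rows `E = 1/10`, `π = 1/100` at `ρ = 10` give `M'' = 366/625 > 0`). [typed predicate of LINE (A)'s r = 1 rung, crit-1 g11 / pen val-idea-25 g9 Sketch-T3 rev 11; a programme statement, not a literature fact — no citation exists] -/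
def ConcaveNumerator (k : ℕ) : Prop :=
  ∀ ρ : ℝ, 1 < ρ → ∀ (E π : Fin k → ℝ), Feasible ρ E π →
    sOmega2 ρ E π + 2 * (2 * bk1 ρ E π - ρ) * sOmega1 ρ E π
      + (2 * bk2 ρ E π + (2 * bk1 ρ E π - ρ) ^ 2) * sOmega ρ E π ≤ 0

end ZeroChangeState

end Summit.ValiantsHypothesis.ValiantsHypothesis.Theorems.LacunarySymmetroidMatrixDescartes
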